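import Mathlib.Analysis.SpecialFunctions.Pow.Real
import Literature.Computability.AlgebraicComplexity.HomogeneousCircuits
import Literature.Computability.AlgebraicComplexity.IMMDepthFour
import HarnessLib

/-!
# Homogeneous `ΣΠΣΠ` (depth-4) circuits in the sense of Kumar–Saraf, and the `n^{Ω(√n)}`
lower bound for `IMM` as printed (Kumar–Saraf 2017, §3, Thm. 1.2 = Thm. 8.10)

Topic `Literature/Computability/AlgebraicComplexity`; companion of `HomogeneousCircuits.lean`
(`homProductDepthCircuitSize`) and `IMMDepthFour.lean` (`kumar_saraf_imm_depth4`).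

## Why this file exists (a model discrepancy)

Kumar–Saraf, SIAM J. Comput. 46 (2017), §3: "By a `ΣΠΣΠ` circuit or a depth 4 circuit, we
mean a circuit of depth 4 with the top layer and the third layer only have sum gates and the
second and the bottom layer have only product gates", depth being "the length of the longest
path from the output node to a leaf node" and size "the total number of nodes"; a homogeneous
`ΣΠΣΠ` circuit computes `P = ∑_{i ≤ T} ∏_j Q_{ij}` with every `Q_{ij}` a *sum of
monomials* (eq. (3.1)). In particular the BOTTOM product gates multiply leaves (variables,
constants).

The tree's measure `homProductDepthCircuitSize 2` (`HomogeneousCircuits.lean`) minimises over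
homogeneous circuits of PRODUCT-DEPTH `≤ 2` (`ArithCircuit.productDepth`: at most two product
gates on a path, any number of sum gates anywhere). Such circuits may have a layer of sum gates
BELOW the bottom products — products of linear forms, i.e. homogeneous `ΣΠΣΠΣ` = homogeneous
depth-5 circuits (`ArithCircuit.exists_productDepth_two_not_isDepthFour` below exhibits one).
Lower bounds against that larger class are a different and much harder matter: over finite
fields only `exp(Ω_q(√d))` is known [Kumar–Saptharishi 2017, Thm. 1], and over characteristic
`0` superpolynomial bounds are known only in the low-degree regime `d ≤ (log N)^{O(1)}`
[Limaye–Srinivasan–Tavenas 2021; Amireddy–Garg–Kayal–Saha–Thankey 2023, Thm. 1.3 and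
Open Problem 1.2: "Prove exponential lower bounds for constant-depth arithmetic formulas. This is
interesting even for homogeneous depth-5 formulas."]. So the `n^{Ω(√n)}` statements of
Kumar–Saraf must be vendored over depth-4 circuits proper, which this file defines.

## Contents

* `ArithCircuit.Gate.layerStep`, `ArithCircuit.gateLayers`, `ArithCircuit.sigmaPiDepth`: each
  gate is placed in a layer of the bottom-up alternating template `Π (1), Σ (2), Π (3), Σ (4),
  Π (5), …` — a product gate in the least odd layer above all its operands, a sum gate in the
  least even layer above them (leaves: layer `0`); `sigmaPiDepth P` is the layer of the output.
  `ArithCircuit.IsDepthFour P := P.sigmaPiDepth ≤ 4` is exactly "every output–leaf path reads,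
  top-down, a subsequence of `Σ Π Σ Π` with the bottom gate a product of leaves or a sum feeding
  no product", i.e. Kumar–Saraf's `ΣΠΣΠ` with layer-skipping wires allowed (inserting unary
  gates restores strict layering at `≤ 3×` the size, immaterial for `n^{Ω(√n)}`).
* `IsDepthFour.productDepth_le` (`≤ 2`), `IsDepthFour.depth_le` (`≤ 4`): real proofs by a joint
  fold induction (`gateWDepths_le_gateLayers`).
* `homDepthFourCircuitSize f : ℕ∞` — least number of gates of a homogeneous (every gate value
  homogeneous, `ArithCircuit.IsHomogeneousCircuit`) depth-4 circuit computing `f`; API: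
  attained by admissible circuits, `homProductDepthCircuitSize 2 f ≤ homDepthFourCircuitSize f`
  (depth-4 circuits have product-depth `≤ 2`, so LOWER bounds transfer from the tree's measure to
  this one and UPPER bounds the other way), `= ⊤` on inhomogeneous `f`, `= 0` on variables and
  constants, `≤ 1` on a product of two variables (a genuine one-gate `ΣΠΣΠ` circuit).
* Named fact `kumarSaraf2017_imm_homDepthFour` (D-0014): Kumar–Saraf 2017, Thm. 1.2 / Thm. 8.10
  AS PRINTED — over every field, homogeneous `ΣΠΣΠ` circuits for `IMM` (trace form
  `immPoly (n^c) n k`, `StandardFamilies.lean`) need `n^{ε√n}` gates for large `n`; and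
  `kumar_saraf_imm_depth4.homDepthFour`: the tree's (stronger, depth-5) rendering implies it.

## Rendering notes

Size here is the tree's gate count (leaves free, weighted unbounded-fan-in sum gates, product
gates with repeated operands), while Kumar–Saraf count all nodes of a `+, ×` circuit. The proof
of their Thm. 8.10 uses the circuit only through the normal form (3.1) `∑_{i ≤ T} ∏_j Q_{ij}`
(`Q_{ij}` sums of monomials), the bound `T ≤ size` (sub-additivity, Lemma 4.1) and the bound
"number of bottom product gates (monomials) of support `≥ s` is `≤ size`" (random
restriction, Lemma 8.2); a homogeneous `IsDepthFour` circuit of the tree has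
exactly this normal form (layer-3 products of layer-2 sums of layer-1 monomials, top fan-in and
number of layer-1 gates both `≤ size`), so the printed argument bounds the tree's gate count by
the same `n^{Ω(√n)}`; conversely a Kumar–Saraf circuit is a tree circuit with at most as many
gates. The fact below only asserts `∃ ε > 0`, as printed (`n^{Ω(√n)}`). The
trace-versus-`(1,1)`-entry remark of `IMMDepthFour.lean` applies verbatim (zero-substitutions
preserve homogeneous depth-4 circuits and do not increase size), and `N = n^{O(1)}` variables
with `n` matrices of dimension `n⁵` (§8.2) is the instance `c = 5` of `immPoly (n^c) n`.

## References

* M. Kumar, S. Saraf, *On the power of homogeneous depth 4 arithmetic circuits*, SIAM J. Comput.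
  46 (2017) 336–387 (arXiv:1404.1950): §3 (model, eq. (3.1)), Thm. 1.2, Cor. 1.3, Thm. 8.10,
  §8.2 (parameters: `n` matrices of dimension `n⁵`).
* M. Kumar, R. Saptharishi, *An exponential lower bound for homogeneous depth-5 circuits over
  finite fields*, CCC 2017, Thm. 1 and §1 ("obvious attempts to generalize the proofs in
  [KLSS, KS14] seem to fail for homogeneous depth-5 circuits").
* P. Amireddy, A. Garg, N. Kayal, C. Saha, B. Thankey, *Low-depth arithmetic circuit lower
  bounds: bypassing set-multilinearization*, ICALP 2023, Thm. 1.3, Rem. 1.4, Open Problem 1.2.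
* N. Limaye, S. Srinivasan, S. Tavenas, *Superpolynomial lower bounds against low-depth
  algebraic circuits*, FOCS 2021, §1–§2 (product depth).
-/

noncomputable section

open MvPolynomial

namespace Literature.Computability.AlgebraicComplexity

universe u v

namespace ArithCircuit

variable {k : Type u} {σ : Type v}

/-! ### Layers of the alternating template `Π Σ Π Σ ⋯` -/

section Layers

/-- The layer of a gate placed on top of operands of maximal layer `s`, in the bottom-up
numbering `Π = 1, Σ = 2, Π = 3, Σ = 4, …` of the alternating layers of a `⋯ΣΠΣΠ` circuit
(leaves have layer `0`): a product gate goes to the least odd layer `> s`, a sum gate to the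
least even layer `> s` (Kumar–Saraf 2017, §3: layers alternate, counted here from the bottom,
whose layer consists of product gates). [cite: KumarSaraf2017, §3] -/
def Gate.layerStep : Gate k σ → ℕ → ℕ
  | .prod _, s => if s % 2 = 0 then s + 1 else s + 2
  | .sum _, s => if s % 2 = 1 then s + 1 else s + 2

/-- The list of layers of a list of gates, by the same total left fold as `gateWDepths`: a gate
sits `Gate.layerStep` above the maximal layer of its operands (variables, constants and junk
references have layer `0`, via `Operand.depthIn`). [cite: KumarSaraf2017, §3] -/
def gateLayers (gs : List (Gate k σ)) : List ℕ :=
  gs.foldl (fun ls g => ls ++ [g.layerStep ((g.args.map (Operand.depthIn ls)).foldr max 0)]) []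

/-- The `ΣΠ`-depth of a circuit: the layer of its output in the bottom-up template
`Π Σ Π Σ ⋯`, i.e. the depth of the least strictly alternating layered circuit (bottom layer of
products) into which `P` embeds. [cite: KumarSaraf2017, §3] -/
def sigmaPiDepth (P : ArithCircuit k σ) : ℕ :=
  P.output.depthIn (gateLayers P.gates)

/-- **Kumar–Saraf's depth-4 (`ΣΠΣΠ`) discipline**: the output lies in layer `≤ 4` of the
template `Π (1) Σ (2) Π (3) Σ (4)`, i.e. along every output–leaf path the gate kinds read
top-down a subsequence of `Σ Π Σ Π` whose bottom product gates multiply leaves only ("a circuit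
of depth 4 with the top layer and the third layer only have sum gates and the second and the
bottom layer have only product gates"; wires may skip layers). [cite: KumarSaraf2017, §3] -/
def IsDepthFour (P : ArithCircuit k σ) : Prop :=
  P.sigmaPiDepth ≤ 4

/-- One step of the fold defining `gateLayers`. [cite: KumarSaraf2017, §3] -/
@[simp] theorem gateLayers_append_singleton (gs : List (Gate k σ)) (g : Gate k σ) :
    gateLayers (gs ++ [g]) =
      gateLayers gs ++
        [g.layerStep ((g.args.map (Operand.depthIn (gateLayers gs))).foldr max 0)] := by
  simp [gateLayers, List.foldl_append]

/-- One layer per gate. [cite: KumarSaraf2017, §3] -/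
@[simp] theorem gateLayers_length (gs : List (Gate k σ)) :
    (gateLayers gs).length = gs.length := by
  induction gs using List.reverseRecOn with
  | nil => rfl
  | append_singleton gs g ih => simp [gateLayers_append_singleton, ih]

/-- A gate lies strictly above its operands. [cite: KumarSaraf2017, §3] -/
theorem lt_layerStep (g : Gate k σ) (s : ℕ) : s < g.layerStep s := by
  cases g <;> simp only [Gate.layerStep] <;> split_ifs <;> omega

/-- An entry of a list of naturals is at most its `foldr max 0`. [folklore] -/
private theorem le_foldr_max_of_mem {l : List ℕ} {x : ℕ} (h : x ∈ l) : x ≤ l.foldr max 0 := by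
  induction l with
  | nil => simp at h
  | cons a l ih =>
    simp only [List.foldr_cons]
    rcases List.mem_cons.1 h with rfl | h
    · exact le_max_left _ _
    · exact (ih h).trans (le_max_right _ _)

/-- `foldr max 0` is bounded by a common bound of the entries. [folklore] -/
private theorem foldr_max_le_of_forall {l : List ℕ} {b : ℕ} (h : ∀ x ∈ l, x ≤ b) :
    l.foldr max 0 ≤ b := by
  induction l with
  | nil => exact Nat.zero_le _
  | cons a l ih =>
    simp only [List.foldr_cons]
    exact max_le (h a (by simp)) (ih fun x hx => h x (by simp [hx]))

/-- Comparison of an operand's weighted depth with a function of its layer, given the gate-wise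
comparison of the two lists. [folklore] -/
private theorem depthIn_le_of_forall₂ {φ : ℕ → ℕ} {ds ls : List ℕ}
    (h : List.Forall₂ (fun d l => d ≤ φ l) ds ls) (u : Operand k σ) :
    u.depthIn ds ≤ φ (u.depthIn ls) := by
  cases u with
  | var i => exact Nat.zero_le _
  | const c => exact Nat.zero_le _
  | gate j =>
    simp only [Operand.depthIn, List.getD_eq_getElem?_getD]
    induction h generalizing j with
    | nil => simp
    | cons hd _ ih =>
      cases j with
      | zero => simpa using hd
      | succ j => simpa using ih j

/-- **Joint fold induction.** If `φ` is monotone and every gate kind satisfies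
`w g + φ s ≤ φ (g.layerStep s)`, then gate-wise `gateWDepths w ≤ φ ∘ gateLayers`. [folklore] -/
theorem gateWDepths_le_gateLayers (w : Gate k σ → ℕ) (φ : ℕ → ℕ) (hφ : Monotone φ)
    (hw : ∀ (g : Gate k σ) (s : ℕ), w g + φ s ≤ φ (g.layerStep s)) (gs : List (Gate k σ)) :
    List.Forall₂ (fun d l => d ≤ φ l) (gateWDepths w gs) (gateLayers gs) := by
  induction gs using List.reverseRecOn with
  | nil => exact List.Forall₂.nil
  | append_singleton gs g ih =>
    rw [gateWDepths_append_singleton, gateLayers_append_singleton]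
    refine List.rel_append ih (List.Forall₂.cons ?_ List.Forall₂.nil)
    refine le_trans (Nat.add_le_add_left ?_ _) (hw g _)
    refine foldr_max_le_of_forall fun x hx => ?_
    obtain ⟨u, hu, rfl⟩ := List.mem_map.1 hx
    exact (depthIn_le_of_forall₂ ih u).trans
      (hφ (le_foldr_max_of_mem (List.mem_map.2 ⟨u, hu, rfl⟩)))

/-- The weighted depth of a circuit is bounded through its `ΣΠ`-depth. [folklore] -/
theorem wdepth_le_of_layerStep (w : Gate k σ → ℕ) (φ : ℕ → ℕ) (hφ : Monotone φ)
    (hw : ∀ (g : Gate k σ) (s : ℕ), w g + φ s ≤ φ (g.layerStep s)) (P : ArithCircuit k σ) :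
    P.wdepth w ≤ φ P.sigmaPiDepth :=
  depthIn_le_of_forall₂ (gateWDepths_le_gateLayers w φ hφ hw P.gates) P.output

/-- **Product-depth versus layers**: a circuit of `ΣΠ`-depth `L` has product-depth
`≤ (L + 1) / 2` (layers `1, 3, 5, …` are the product layers). [cite: KumarSaraf2017, §3] -/
theorem productDepth_le_sigmaPiDepth (P : ArithCircuit k σ) :
    P.productDepth ≤ (P.sigmaPiDepth + 1) / 2 := by
  refine wdepth_le_of_layerStep _ (fun L => (L + 1) / 2) (fun a b h => by
    simp only; omega) (fun g s => ?_) P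
  cases g with
  | sum args =>
    simp only [Gate.isProd, Gate.layerStep, Bool.false_eq_true, ↓reduceIte]
    split_ifs <;> omega
  | prod args => simp only [Gate.isProd, Gate.layerStep, ↓reduceIte]; split_ifs <;> omega

/-- **Depth versus layers**: a circuit of `ΣΠ`-depth `L` has depth `≤ L`.
[cite: KumarSaraf2017, §3] -/
theorem depth_le_sigmaPiDepth (P : ArithCircuit k σ) : P.depth ≤ P.sigmaPiDepth := by
  refine wdepth_le_of_layerStep _ id (fun a b h => h) (fun g s => ?_) P
  have := lt_layerStep g s
  simp only [id]
  omega

/-- A depth-4 circuit has product-depth at most `2`. [cite: KumarSaraf2017, §3] -/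
theorem IsDepthFour.productDepth_le {P : ArithCircuit k σ} (h : P.IsDepthFour) :
    P.productDepth ≤ 2 :=
  (productDepth_le_sigmaPiDepth P).trans (by unfold IsDepthFour at h; omega)

/-- A depth-4 circuit has depth at most `4`. [cite: KumarSaraf2017, §3] -/
theorem IsDepthFour.depth_le {P : ArithCircuit k σ} (h : P.IsDepthFour) : P.depth ≤ 4 :=
  (depth_le_sigmaPiDepth P).trans h

/-- Gateless circuits have `ΣΠ`-depth `0`: variables. [cite: KumarSaraf2017, §3] -/
@[simp] theorem sigmaPiDepth_ofVar (i : σ) : (ofVar i : ArithCircuit k σ).sigmaPiDepth = 0 :=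
  rfl

/-- Gateless circuits have `ΣΠ`-depth `0`: constants. [cite: KumarSaraf2017, §3] -/
@[simp] theorem sigmaPiDepth_ofConst (c : k) : (ofConst c : ArithCircuit k σ).sigmaPiDepth = 0 :=
  rfl

/-- The input circuit `ofVar i` is depth-4. [cite: KumarSaraf2017, §3] -/
theorem isDepthFour_ofVar (i : σ) : (ofVar i : ArithCircuit k σ).IsDepthFour := Nat.zero_le _

/-- The constant circuit `ofConst c` is depth-4. [cite: KumarSaraf2017, §3] -/
theorem isDepthFour_ofConst (c : k) : (ofConst c : ArithCircuit k σ).IsDepthFour :=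
  Nat.zero_le _

/-- **The discrepancy, in the model.** Product-depth `≤ 2` does NOT imply depth four: the
circuit `g₀ = x₀ + x₁`, `g₁ = g₀ · g₀`, `g₂ = g₁`, `g₃ = g₂ · g₂` (a product of linear forms fed
through a sum into another product — the homogeneous `ΣΠΣΠΣ` = depth-5 shape) has
product-depth `2` but `ΣΠ`-depth `5`. [cite: KumarSaraf2017, §3] -/
theorem exists_productDepth_two_not_isDepthFour :
    ∃ P : ArithCircuit ℚ (Fin 2), P.productDepth = 2 ∧ P.sigmaPiDepth = 5 ∧ ¬ P.IsDepthFour :=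
  ⟨⟨[.sum [(1, .var 0), (1, .var 1)], .prod [.gate 0, .gate 0], .sum [(1, .gate 1)],
    .prod [.gate 2, .gate 2]], .gate 3⟩, by decide, by decide, by unfold IsDepthFour; decide⟩

end Layers

end ArithCircuit

/-! ### The homogeneous depth-4 size measure -/

section Measures

variable {k : Type u} {σ : Type v} [CommSemiring k]

/-- The **homogeneous depth-4 (`ΣΠΣΠ`) circuit size** of `f`: the least number of gates of a
homogeneous (every gate computes a homogeneous polynomial, `ArithCircuit.IsHomogeneousCircuit`),
unbounded fan-in circuit in Kumar–Saraf's depth-4 discipline (`ArithCircuit.IsDepthFour`)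
computing `f`; valued in `ℕ∞`, `⊤` if there is none (e.g. `f` inhomogeneous). This — and not
`homProductDepthCircuitSize 2`, which also admits homogeneous depth-5 circuits — is the size
measure of the lower bounds of Gupta–Kamath–Kayal–Saptharishi, Kayal–Limaye–Saha–Srinivasan
and Kumar–Saraf. [cite: KumarSaraf2017, §3] -/
def homDepthFourCircuitSize (f : MvPolynomial σ k) : ℕ∞ :=
  ⨅ (P : ArithCircuit k σ) (_ : P.Computes f ∧ P.IsDepthFour ∧ P.IsHomogeneousCircuit),
    (P.size : ℕ∞)

/-- The infimum defining `homDepthFourCircuitSize` is attained by every admissible circuit.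
[cite: KumarSaraf2017, §3] -/
theorem homDepthFourCircuitSize_le {f : MvPolynomial σ k} {P : ArithCircuit k σ}
    (hf : P.Computes f) (h4 : P.IsDepthFour) (hh : P.IsHomogeneousCircuit) :
    homDepthFourCircuitSize f ≤ P.size :=
  iInf₂_le P ⟨hf, h4, hh⟩

/-- **Depth-4 circuits are product-depth-2 circuits**: the tree's homogeneous product-depth-2
size is at most the homogeneous depth-4 size. Consequently LOWER bounds for
`homProductDepthCircuitSize 2` imply lower bounds for `homDepthFourCircuitSize`, and UPPER
bounds (Tavenas) for the latter imply those for the former. [cite: KumarSaraf2017, §3] -/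
theorem homProductDepthCircuitSize_two_le_homDepthFourCircuitSize (f : MvPolynomial σ k) :
    homProductDepthCircuitSize 2 f ≤ homDepthFourCircuitSize f :=
  le_iInf₂ fun _ hP => homProductDepthCircuitSize_le hP.1 hP.2.1.productDepth_le hP.2.2

/-- The general product-depth-2 size is at most the homogeneous depth-4 size.
[cite: KumarSaraf2017, §3] -/
theorem productDepthCircuitSize_two_le_homDepthFourCircuitSize (f : MvPolynomial σ k) :
    productDepthCircuitSize 2 f ≤ homDepthFourCircuitSize f :=
  (productDepthCircuitSize_le_homProductDepthCircuitSize 2 f).trans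
    (homProductDepthCircuitSize_two_le_homDepthFourCircuitSize f)

/-- An inhomogeneous polynomial has no homogeneous depth-4 circuit: the measure is `⊤`.
[cite: KumarSaraf2017, §3] -/
theorem homDepthFourCircuitSize_eq_top {f : MvPolynomial σ k}
    (hf : ∀ e : ℕ, ¬ f.IsHomogeneous e) :
    homDepthFourCircuitSize f = ⊤ :=
  eq_top_mono (homProductDepthCircuitSize_two_le_homDepthFourCircuitSize f)
    (homProductDepthCircuitSize_eq_top hf)

/-- Non-vacuity: a variable has homogeneous depth-4 size `0`. [cite: KumarSaraf2017, §3] -/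
@[simp] theorem homDepthFourCircuitSize_X (i : σ) :
    homDepthFourCircuitSize (X i : MvPolynomial σ k) = 0 :=
  nonpos_iff_eq_zero.1 (homDepthFourCircuitSize_le (P := ArithCircuit.ofVar i) rfl
    (ArithCircuit.isDepthFour_ofVar i) (ArithCircuit.isHomogeneousCircuit_ofVar i))

/-- Non-vacuity: a constant has homogeneous depth-4 size `0`. [cite: KumarSaraf2017, §3] -/
@[simp] theorem homDepthFourCircuitSize_C (c : k) :
    homDepthFourCircuitSize (C c : MvPolynomial σ k) = 0 :=
  nonpos_iff_eq_zero.1 (homDepthFourCircuitSize_le (P := ArithCircuit.ofConst c) rfl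
    (ArithCircuit.isDepthFour_ofConst c) (ArithCircuit.isHomogeneousCircuit_ofConst c))

/-- Non-vacuity with a gate: the one-gate circuit `x_i · x_j` (a bottom product of leaves, layer
`1`) is a homogeneous depth-4 circuit, so `homDepthFourCircuitSize (X i * X j) ≤ 1`.
[cite: KumarSaraf2017, §3] -/
theorem homDepthFourCircuitSize_X_mul_X_le (i j : σ) :
    homDepthFourCircuitSize (X i * X j : MvPolynomial σ k) ≤ 1 := by
  let P : ArithCircuit k σ := ⟨[.prod [.var i, .var j]], .gate 0⟩
  have hval : ArithCircuit.gateValues P.gates = [X i * X j] := by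
    simp [P, ArithCircuit.gateValues, ArithCircuit.Gate.eval, ArithCircuit.Operand.eval]
  have hP : P.Computes (X i * X j) := by
    change (ArithCircuit.Operand.gate 0 : ArithCircuit.Operand k σ).eval
      (ArithCircuit.gateValues P.gates) = _
    rw [hval]
    rfl
  have h4 : P.IsDepthFour := show P.sigmaPiDepth ≤ 4 by
    rw [show P.sigmaPiDepth = 1 from rfl]; norm_num
  have hh : P.IsHomogeneousCircuit := by
    intro g hg
    rw [hval, List.mem_singleton] at hg
    subst hg
    exact ⟨2, (isHomogeneous_X k i).mul (isHomogeneous_X k j)⟩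
  exact homDepthFourCircuitSize_le hP h4 hh

end Measures

/-! ### Kumar–Saraf 2017, Thm. 1.2 / Thm. 8.10, as printed (named fact, D-0014) -/

/-- NAMED FACT (**Kumar–Saraf 2017, Thm. 1.2 (Main Theorem) = Thm. 8.10**, all fields): "There
exists an explicit family of polynomials (over `𝔽`) of degree `n` and in `N = n^{O(1)}` variables
in `VP`, such that any homogeneous `ΣΠΣΠ` circuit computing it has size at least `n^{Ω(√n)}`",
the polynomial being `IMM` — the `(1,1)` entry of the product of `n` generic `ñ × ñ` matrices,
`ñ = n⁵` (§8.1–§8.2), Thm. 8.10: "Any homogeneous `ΣΠΣΠ` circuit computing the polynomial `IMM`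
has size at least `2^{Ω(√n log n)}`." Rendered over the depth-4 measure `homDepthFourCircuitSize`
of this file and the trace form `immPoly (n^c) n k` of `StandardFamilies.lean` (a
zero-substitution image of which is the `(1,1)` entry; see the module docstring for the size
conventions): for every field `k` there are `c`, `n₀` and `ε > 0` with
`⌈n^{ε√n}⌉ ≤ homDepthFourCircuitSize (immPoly (n^c) n k)` for all `n ≥ n₀`. This is the
printed statement; the tree's earlier rendering `kumar_saraf_imm_depth4` (`IMMDepthFour.lean`)
quantifies over the larger class of homogeneous product-depth-2 (= depth-5) circuits and is
therefore a STRONGER assertion than print (it implies this one: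
`kumar_saraf_imm_depth4.homDepthFour`). Users take `(h : kumarSaraf2017_imm_homDepthFour)`.
[cite: KumarSaraf2017, Thm. 1.2 and Thm. 8.10] -/
def kumarSaraf2017_imm_homDepthFour : Prop :=
  ∀ (k : Type) [Field k], ∃ (c n₀ : ℕ) (ε : ℝ), 0 < ε ∧ ∀ n : ℕ, n₀ ≤ n →
    ((⌈(n : ℝ) ^ (ε * Real.sqrt n)⌉₊ : ℕ) : ℕ∞) ≤ homDepthFourCircuitSize (immPoly (n ^ c) n k)

/-- The tree's product-depth-2 rendering of the Kumar–Saraf bound implies the printed depth-4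
statement (`homProductDepthCircuitSize 2 ≤ homDepthFourCircuitSize`).
[cite: KumarSaraf2017, Thm. 1.2] -/
theorem kumar_saraf_imm_depth4.homDepthFour (h : kumar_saraf_imm_depth4) :
    kumarSaraf2017_imm_homDepthFour := by
  intro k _
  obtain ⟨c, n₀, ε, hε, hn⟩ := h k
  exact ⟨c, n₀, ε, hε, fun n hn' =>
    (hn n hn').trans (homProductDepthCircuitSize_two_le_homDepthFourCircuitSize _)⟩

/-- Consequence shape of the printed bound: in the barrier regime no homogeneous `ΣΠΣΠ` circuit
for `IMM` of size below `n^{ε√n}` exists. [cite: KumarSaraf2017, Thm. 8.10] -/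
theorem homDepthFourCircuitSize_imm_ge (h : kumarSaraf2017_imm_homDepthFour) (k : Type)
    [Field k] :
    ∃ (c n₀ : ℕ) (ε : ℝ), 0 < ε ∧ ∀ n : ℕ, n₀ ≤ n → ∀ s : ℕ,
      homDepthFourCircuitSize (immPoly (n ^ c) n k) = s → ⌈(n : ℝ) ^ (ε * Real.sqrt n)⌉₊ ≤ s := by
  obtain ⟨c, n₀, ε, hε, hn⟩ := h k
  refine ⟨c, n₀, ε, hε, fun n hn' s hs => ?_⟩
  have := hn n hn'
  rw [hs] at this
  exact_mod_cast this

end Literature.Computability.AlgebraicComplexity
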